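import Mathlib
import Summits.KontsevichZagierPeriods.Zeta5Search.ClusterValuation
import Summits.KontsevichZagierPeriods.Zeta5Search.BigPrimePoles
import HarnessLib

/-!
# ζ(5) search — the partial-fraction coefficients of `R_b` as power-series coefficients of the REDUCED local factorisation

Cell `pub-zeta5` (HONEST FRAMING: systematic search; no irrationality claim unless certified), typer seat
generation 8.  Algebraic half (no primes) of the Lean proof of gen-2's CLUSTER BOUND (Theorem A,
`ClusterValuation.ClusterBound`), Theorem A′ and `ClassVBound`; the `p`-adic half is
`Zeta5Search/ClusterBoundProof.lean`.  Identities of rational polynomials / power series only.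

With `n = b₀`, `y = t+1`, the summand of Brown–Zudilin's dual series is `R_b(y) = numPoly_b(y)/∏_{s≤n}(y+s)^6`
and `pfData b o q = c_{o,q}` is the coefficient of `(y+q)^{−(o+1)}` (`WedgeDictionary.IsPFData`).  In NET-EXPONENT
form `R_b(y) = (2y+n)·∏_{s≤n} (y+s)^{1−blockCount s}`; the multiplicity of the factor `(y+q)` including the centre
is `mult b q − 6` with `mult b q = 7 − blockCount q + [2q = n]` (`= netExp q + 6`).  Contents:

* `taylor_numR_eq` — at the pole `y = −q`:
  `numPoly_b(X − q) = X^{mult q} · cen · ∏_{s ≠ q} (X + (s−q))^{mult s}` in `ℚ[X]`, where the CENTRE FACTOR `cen`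
  is the constant `2` for even `n` (the zero `y = −n/2` then sits on the lattice and is absorbed in `mult`) and
  `2X + (n − 2q)` for odd `n` (`cenP`);
* `Gser b q = cen · ∏_{s ≠ q} (X + (s−q))^{mult s} · ((X + (s−q))^6)⁻¹ ∈ ℚ⟦X⟧` — the regular part of `R_b` at the
  pole, each position `s` carrying its net exponent — and **`pfData_eq_coeff_Gser`**:
  `c_{o,q} = [X^{5−o}] (X^{mult q} · Gser b q)` for `o < 6`, `q ≤ n` (from `BigPrimePoles.taylor_numPoly_congr` and the
  inverse of `E_q = ∏_{s≠q}(X+(s−q))^6` in `ℚ⟦X⟧`).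
-/

noncomputable section

open Finset

namespace Summit.KontsevichZagierPeriods.Zeta5Search.ClusterValuation

open Summit.KontsevichZagierPeriods.Zeta5Search.DualSeries (InBox numPoly)
open Summit.KontsevichZagierPeriods.Zeta5Search.WedgeDictionary (IsPFData)
open Summit.KontsevichZagierPeriods.Zeta5Search.BigPrime (block numR ER taylor_numPoly_congr numPoly_eq_numR
  taylor_prod' taylor_X_add_C)

/-! ### The multiplicity function and the centre factor -/

/-- `mult b s = 7 − blockCount s + [2s = b₀]`: the multiplicity of the root `−s` of `numPoly b` (`= netExp s + 6`). -/
def mult (b : ℕ → ℤ) (s : ℕ) : ℕ := 7 - blockCount b s + (if 2 * (s : ℤ) = b 0 then 1 else 0)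

/-- `blockCount ≤ 7`. -/
theorem blockCount_le (b : ℕ → ℤ) (s : ℕ) : blockCount b s ≤ 7 := by
  unfold blockCount
  exact (card_filter_le _ _).trans (by simp)

/-- `mult s = netExp s + 6`. -/
theorem mult_eq_netExp (b : ℕ → ℤ) (s : ℕ) : (mult b s : ℤ) = netExp b s + 6 := by
  have h := blockCount_le b s
  unfold mult netExp
  split_ifs <;> push_cast <;> omega

section Poly

open Polynomial

/-- The centre factor at the pole `q` (in `ℚ[X]`): `2` for even `b₀`, `2X + (b₀ − 2q)` for odd `b₀`. -/
def cenP (b : ℕ → ℤ) (q : ℕ) : ℚ[X] :=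
  if (2 : ℤ) ∣ b 0 then C 2 else C 2 * X + C ((((b 0).toNat : ℕ) : ℚ) - 2 * q)

/-- Regrouping the block-complement products by position:
`∏_{j<7} ∏_{s ∈ [0,n]∖block_j} (X + (s−q)) = ∏_{s ≤ n} (X + (s−q))^{7 − blockCount s}`. -/
theorem prod_compl_eq_prod_pow (b : ℕ → ℤ) (q : ℕ) :
    ∏ j ∈ range 7, ∏ s ∈ range ((b 0).toNat + 1) \ block (b 0).toNat (b (j + 1)).toNat,
        (X + C ((s : ℚ) - q)) =
      ∏ s ∈ range ((b 0).toNat + 1), (X + C ((s : ℚ) - q)) ^ (7 - blockCount b s) := by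
  have h1 : ∀ j ∈ range 7,
      ∏ s ∈ range ((b 0).toNat + 1) \ block (b 0).toNat (b (j + 1)).toNat, (X + C ((s : ℚ) - q)) =
        ∏ s ∈ range ((b 0).toNat + 1),
          (if s ∉ block (b 0).toNat (b (j + 1)).toNat then X + C ((s : ℚ) - q) else 1) := by
    intro j _
    rw [sdiff_eq_filter, prod_filter]
  rw [prod_congr rfl h1, prod_comm]
  refine prod_congr rfl fun s _ => ?_
  rw [← prod_filter, prod_const]
  congr 1
  have := card_filter_add_card_filter_not (s := range 7) (fun j => s ∈ block (b 0).toNat (b (j + 1)).toNat)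
  simp only [card_range] at this
  unfold blockCount
  omega

/-- `taylor (−q)` of the block-form numerator:
`numR(X − q) = (2X + (n − 2q)) · ∏_{s ≤ n} (X + (s − q))^{7 − blockCount s}`. -/
theorem taylor_numR (b : ℕ → ℤ) (q : ℕ) :
    taylor (-(q : ℚ)) (numR ℚ (b 0).toNat (fun j => (b (j + 1)).toNat)) =
      (C 2 * X + C ((((b 0).toNat : ℕ) : ℚ) - 2 * q)) *
        ∏ s ∈ range ((b 0).toNat + 1), (X + C ((s : ℚ) - q)) ^ (7 - blockCount b s) := by
  rw [numR, taylor_mul, taylor_prod']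
  have hlin : taylor (-(q : ℚ)) (C 2 * X + C (((b 0).toNat : ℕ) : ℚ)) =
      C 2 * X + C ((((b 0).toNat : ℕ) : ℚ) - 2 * q) := by
    rw [map_add, taylor_mul, taylor_C, taylor_C, taylor_X, C_sub, C_neg, C_mul]
    ring
  rw [hlin, ← prod_compl_eq_prod_pow b q]
  congr 1
  refine prod_congr rfl fun j _ => ?_
  rw [taylor_prod']
  refine prod_congr rfl fun s _ => ?_
  rw [taylor_X_add_C, sub_eq_add_neg]

/-- **The reduced local factorisation at the pole `q ≤ n`**:
`numR(X − q) = X^{mult q} · (cen · ∏_{s ≤ n, s ≠ q} (X + (s−q))^{mult s})`. -/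
theorem taylor_numR_eq (b : ℕ → ℤ) (h0 : 0 ≤ b 0) {q : ℕ} (hq : q ≤ (b 0).toNat) :
    taylor (-(q : ℚ)) (numR ℚ (b 0).toNat (fun j => (b (j + 1)).toNat)) =
      X ^ (mult b q) * (cenP b q *
        ∏ s ∈ (range ((b 0).toNat + 1)).erase q, (X + C ((s : ℚ) - q)) ^ (mult b s)) := by
  set n := (b 0).toNat with hn
  have hb0 : (b 0 : ℤ) = n := by rw [hn, Int.toNat_of_nonneg h0]
  have hqmem : q ∈ range (n + 1) := mem_range.2 (by omega)
  rw [taylor_numR, ← mul_prod_erase _ _ hqmem, sub_self, C_0, add_zero]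
  -- now: (2X + (n-2q)) * (X^{7-bc q} * ∏_{s≠q} lin_s^{7 - bc s}) = X^{mult q} * (cen * ∏_{s≠q} lin_s^{mult s})
  by_cases hev : (2 : ℤ) ∣ b 0
  · -- even `b₀`
    have hcen : cenP b q = C 2 := by simp [cenP, hev]
    rw [hcen]
    by_cases hq2 : 2 * (q : ℤ) = b 0
    · -- the centre IS the pole `q`: `2X + (n - 2q) = 2X`, absorbed into `X^{mult q}`
      have hmq : mult b q = 7 - blockCount b q + 1 := by simp [mult, hq2]
      have hconst : ((n : ℕ) : ℚ) - 2 * q = 0 := by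
        have : (n : ℤ) = 2 * q := by omega
        have : (n : ℚ) = 2 * q := by exact_mod_cast this
        rw [this, sub_self]
      have hrest : ∀ s ∈ (range (n + 1)).erase q, mult b s = 7 - blockCount b s := by
        intro s hs
        have hsq : s ≠ q := (mem_erase.1 hs).1
        have : ¬ (2 * (s : ℤ) = b 0) := by omega
        simp [mult, this]
      have hR : ∏ s ∈ (range (n + 1)).erase q, (X + C ((s : ℚ) - q)) ^ (mult b s) =
          ∏ s ∈ (range (n + 1)).erase q, (X + C ((s : ℚ) - q)) ^ (7 - blockCount b s) :=
        prod_congr rfl fun s hs => by rw [hrest s hs]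
      rw [hR, hconst, C_0, add_zero, hmq, pow_succ]
      ring
    · -- the centre is another lattice point `s₀ = n/2 ≠ q` of `[0,n]`: merge `2(X + (s₀ - q))` into its factor
      obtain ⟨m, hm⟩ := hev
      have hm0 : 0 ≤ m := by omega
      set s₀ := m.toNat with hs₀
      have hs₀m : (s₀ : ℤ) = m := Int.toNat_of_nonneg hm0
      have hs₀n : 2 * s₀ = n := by omega
      have hs₀q : s₀ ≠ q := by intro h; apply hq2; rw [← h]; omega
      have hmem : s₀ ∈ (range (n + 1)).erase q := mem_erase.2 ⟨hs₀q, mem_range.2 (by omega)⟩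
      have hmq : mult b q = 7 - blockCount b q := by simp [mult, hq2]
      have hms₀ : mult b s₀ = 7 - blockCount b s₀ + 1 := by
        have : 2 * (s₀ : ℤ) = b 0 := by omega
        simp [mult, this]
      have hrest : ∀ s ∈ ((range (n + 1)).erase q).erase s₀, mult b s = 7 - blockCount b s := by
        intro s hs
        have hs1 : s ≠ s₀ := (mem_erase.1 hs).1
        have : ¬ (2 * (s : ℤ) = b 0) := by
          intro h; apply hs1; omega
        simp [mult, this]
      have hconst : ((n : ℕ) : ℚ) - 2 * q = 2 * ((s₀ : ℚ) - q) := by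
        have : (n : ℚ) = 2 * s₀ := by exact_mod_cast hs₀n.symm
        rw [this]; ring
      have hR : ∏ s ∈ ((range (n + 1)).erase q).erase s₀, (X + C ((s : ℚ) - q)) ^ (mult b s) =
          ∏ s ∈ ((range (n + 1)).erase q).erase s₀, (X + C ((s : ℚ) - q)) ^ (7 - blockCount b s) :=
        prod_congr rfl fun s hs => by rw [hrest s hs]
      rw [← mul_prod_erase _ (fun s : ℕ => (X + C ((s : ℚ) - q)) ^ (7 - blockCount b s)) hmem,
        ← mul_prod_erase _ (fun s : ℕ => (X + C ((s : ℚ) - q)) ^ (mult b s)) hmem, hR, hconst, hmq, hms₀,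
        pow_succ, C_mul]
      ring
  · -- odd `b₀`: nothing is absorbed
    have hcen : cenP b q = C 2 * X + C (((n : ℕ) : ℚ) - 2 * q) := by simp [cenP, hev, hn]
    have hall : ∀ s, mult b s = 7 - blockCount b s := by
      intro s
      have : ¬ (2 * (s : ℤ) = b 0) := by intro h; apply hev; exact ⟨s, by omega⟩
      simp [mult, this]
    have hR : ∏ s ∈ (range (n + 1)).erase q, (X + C ((s : ℚ) - q)) ^ (mult b s) =
        ∏ s ∈ (range (n + 1)).erase q, (X + C ((s : ℚ) - q)) ^ (7 - blockCount b s) :=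
      prod_congr rfl fun s _ => by rw [hall s]
    rw [hcen, hall q, hR]
    ring

end Poly

/-! ### The power series `Gser` and the coefficient identity -/

section Series

open PowerSeries

/-- The linear factor `X + δ` in `ℚ⟦X⟧`. -/
def linS (δ : ℚ) : PowerSeries ℚ := X + C δ

/-- The polynomial `X + C δ` coerces to `linS δ`. -/
theorem coe_X_add_C (δ : ℚ) : ((Polynomial.X + Polynomial.C δ : Polynomial ℚ) : PowerSeries ℚ) = linS δ := by
  rw [Polynomial.coe_add, Polynomial.coe_X, Polynomial.coe_C, linS]

/-- Constant coefficient of a power of a linear factor. -/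
theorem constantCoeff_linS_pow (δ : ℚ) (m : ℕ) : constantCoeff (linS δ ^ m) = δ ^ m := by
  rw [map_pow, linS, map_add, constantCoeff_X, constantCoeff_C, zero_add]

/-- `(X+δ)^a · ((X+δ)^6)⁻¹ = (X+δ)^{a−6}` for `a ≥ 6`, `δ ≠ 0`. -/
theorem linS_pow_mul_inv {δ : ℚ} (hδ : δ ≠ 0) {a : ℕ} (ha : 6 ≤ a) :
    linS δ ^ a * (linS δ ^ 6)⁻¹ = linS δ ^ (a - 6) := by
  have h6 : constantCoeff (linS δ ^ 6) ≠ 0 := by rw [constantCoeff_linS_pow]; exact pow_ne_zero _ hδ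
  conv_lhs => rw [show a = (a - 6) + 6 by omega, pow_add]
  rw [mul_assoc, PowerSeries.mul_inv_cancel _ h6, mul_one]

/-- The inverse of `E_q = ∏_{s ≠ q} (X + (s−q))^6` in `ℚ⟦X⟧`, factor by factor. -/
def Einv (b : ℕ → ℤ) (q : ℕ) : PowerSeries ℚ :=
  ∏ s ∈ (range ((b 0).toNat + 1)).erase q, (linS ((s : ℚ) - q) ^ 6)⁻¹

/-- `E_q · Einv = 1`. -/
theorem coe_ER_mul_Einv (b : ℕ → ℤ) (q : ℕ) :
    ((ER ℚ (b 0).toNat q : Polynomial ℚ) : PowerSeries ℚ) * Einv b q = 1 := by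
  have hE : ((ER ℚ (b 0).toNat q : Polynomial ℚ) : PowerSeries ℚ) =
      ∏ s ∈ (range ((b 0).toNat + 1)).erase q, linS ((s : ℚ) - q) ^ 6 := by
    rw [ER, ← Polynomial.coeToPowerSeries.ringHom_apply, map_prod]
    refine prod_congr rfl fun s _ => ?_
    rw [map_pow, Polynomial.coeToPowerSeries.ringHom_apply, coe_X_add_C]
  rw [hE, Einv, ← prod_mul_distrib]
  refine prod_eq_one fun s hs => ?_
  have hsq : s ≠ q := (mem_erase.1 hs).1
  refine PowerSeries.mul_inv_cancel _ ?_
  rw [constantCoeff_linS_pow]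
  refine pow_ne_zero _ (sub_ne_zero.2 ?_)
  exact_mod_cast hsq

/-- **The regular part of `R_b` at the pole `q`**:
`Gser b q = cen · ∏_{s ≠ q} (X + (s−q))^{mult s} · ((X + (s−q))^6)⁻¹`. -/
def Gser (b : ℕ → ℤ) (q : ℕ) : PowerSeries ℚ :=
  (cenP b q : PowerSeries ℚ) *
    ∏ s ∈ (range ((b 0).toNat + 1)).erase q, (linS ((s : ℚ) - q) ^ mult b s * (linS ((s : ℚ) - q) ^ 6)⁻¹)

/-- `numR(X − q) · Einv = X^{mult q} · Gser b q` in `ℚ⟦X⟧`. -/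
theorem coe_taylor_numR_mul_Einv (b : ℕ → ℤ) (h0 : 0 ≤ b 0) {q : ℕ} (hq : q ≤ (b 0).toNat) :
    ((Polynomial.taylor (-(q : ℚ)) (numR ℚ (b 0).toNat (fun j => (b (j + 1)).toNat))) : PowerSeries ℚ) *
        Einv b q = X ^ mult b q * Gser b q := by
  have hP : ((∏ s ∈ (range ((b 0).toNat + 1)).erase q,
      (Polynomial.X + Polynomial.C ((s : ℚ) - q)) ^ mult b s : Polynomial ℚ) : PowerSeries ℚ) =
        ∏ s ∈ (range ((b 0).toNat + 1)).erase q, linS ((s : ℚ) - q) ^ mult b s := by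
    rw [← Polynomial.coeToPowerSeries.ringHom_apply, map_prod]
    simp only [map_pow, Polynomial.coeToPowerSeries.ringHom_apply, coe_X_add_C]
  rw [taylor_numR_eq b h0 hq, Polynomial.coe_mul, Polynomial.coe_pow, Polynomial.coe_X, Polynomial.coe_mul, hP,
    Gser, Einv, mul_assoc, mul_assoc, ← prod_mul_distrib]

/-- The coefficient of the partial-fraction ansatz polynomial `S = Σ_{o<6} c_{o,q} X^{5−o}`. -/
theorem coeff_ansatz (c : ℕ → ℕ → ℚ) (q : ℕ) {o : ℕ} (ho : o < 6) :
    PowerSeries.coeff (5 - o)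
        ((∑ o' ∈ range 6, Polynomial.C (c o' q) * Polynomial.X ^ (5 - o') : Polynomial ℚ) : PowerSeries ℚ) =
      c o q := by
  rw [Polynomial.coeff_coe, Polynomial.finsetSum_coeff, sum_eq_single o]
  · rw [Polynomial.coeff_C_mul, Polynomial.coeff_X_pow, if_pos rfl, mul_one]
  · intro o' ho' hne
    have : (5 - o : ℕ) ≠ 5 - o' := by have := mem_range.1 ho'; omega
    rw [Polynomial.coeff_C_mul, Polynomial.coeff_X_pow, if_neg this, mul_zero]
  · intro h; exact absurd (mem_range.2 ho) h

/-- **The partial-fraction coefficients are power-series coefficients of the reduced factorisation**: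
for data `c` of `R_b` (`b` in the box with `2b_j ≤ b₀+1`), `c_{o,q} = [X^{5−o}] (X^{mult q} · Gser b q)`. -/
theorem pf_eq_coeff_Gser (b : ℕ → ℤ) (hb : InBox b) (hhalf : ∀ j ∈ range 7, 2 * b (j + 1) ≤ b 0 + 1)
    {c : ℕ → ℕ → ℚ} (hc : IsPFData b c) {q : ℕ} (hq : q ≤ (b 0).toNat) {o : ℕ} (ho : o < 6) :
    c o q = PowerSeries.coeff (5 - o) (X ^ mult b q * Gser b q) := by
  have h1 := taylor_numPoly_congr b hc hq
  rw [numPoly_eq_numR b hb hhalf] at h1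
  -- pass to power series and multiply by `Einv`
  set T : Polynomial ℚ := Polynomial.taylor (-(q : ℚ)) (numR ℚ (b 0).toNat (fun j => (b (j + 1)).toNat)) with hT
  set S : Polynomial ℚ := ∑ o' ∈ range 6, Polynomial.C (c o' q) * Polynomial.X ^ (5 - o') with hS
  set E : Polynomial ℚ := ER ℚ (b 0).toNat q with hE
  have h2 : (X : PowerSeries ℚ) ^ 6 ∣ (T : PowerSeries ℚ) - (S : PowerSeries ℚ) * (E : PowerSeries ℚ) := by
    have := map_dvd (Polynomial.coeToPowerSeries.ringHom (R := ℚ)) h1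
    simpa [Polynomial.coeToPowerSeries.ringHom_apply] using this
  have h3 : (X : PowerSeries ℚ) ^ 6 ∣ (T : PowerSeries ℚ) * Einv b q - (S : PowerSeries ℚ) := by
    have hSE : (S : PowerSeries ℚ) = (S : PowerSeries ℚ) * (E : PowerSeries ℚ) * Einv b q := by
      rw [mul_assoc, hE, coe_ER_mul_Einv, mul_one]
    have : (T : PowerSeries ℚ) * Einv b q - (S : PowerSeries ℚ) =
        ((T : PowerSeries ℚ) - (S : PowerSeries ℚ) * (E : PowerSeries ℚ)) * Einv b q := by
      conv_lhs => rw [hSE]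
      ring
    rw [this]
    exact h2.mul_right _
  have h4 : PowerSeries.coeff (5 - o) ((T : PowerSeries ℚ) * Einv b q - (S : PowerSeries ℚ)) = 0 :=
    (PowerSeries.X_pow_dvd_iff.1 h3) (5 - o) (by omega)
  rw [map_sub, sub_eq_zero, hT, coe_taylor_numR_mul_Einv b hb.1 hq, hS, coeff_ansatz c q ho] at h4
  exact h4.symm

end Series

end Summit.KontsevichZagierPeriods.Zeta5Search.ClusterValuation

end
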